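import Summits.QuantumFields.YangMills.Theorems.FiniteRankMirrorPeeling
import Summits.QuantumFields.YangMills.Theses.UniversalDetector
import HarnessLib

/-!
# Route `UniversalDetector`, LINE g9-3 «Hölder-gradient peeling» — the shared support item `TwoCubePeeling`

Ideator seat ym-idea-8 (generation 9).  The support item `UniversalDetector.TwoCubePeeling` (two-cube Markov peeling:
`|Cov_T(F₁, F₂)| ≤ 2‖E[F₁|∂Q₁] − p₁‖₂·‖E[F₂|∂Q₂] − p₂‖₂` for bounded continuous cylinder observables in two window cubes
separated by a full collar) has the same statement as `FiniteRankMirror.TwoCubePeeling` (stmt-QuantumFields-23838),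
proved in `Theorems/FiniteRankMirrorPeeling` (`twoCube_peel`); this file records the identification for the route
`UniversalDetector`.

HONEST FRAMING: folklore DLR bookkeeping; no summit is proved by this line; not Clay.
-/

/-- Item `TwoCubePeeling` of route `UniversalDetector` (same statement as `FiniteRankMirror.TwoCubePeeling`). [folklore] -/
theorem Summit.QuantumFields.YangMills.Theorems.universalDetector_twoCubePeeling :
    Summit.QuantumFields.YangMills.Theses.UniversalDetector.TwoCubePeeling :=
  Summit.QuantumFields.YangMills.Theorems.finiteRankMirror_twoCubePeeling
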